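import Summits.BirchSwinnertonDyer.Rank1Residual.Additive.XGordRankZeroOneCyclotomicThreeLowerSumFibre
import Summits.BirchSwinnertonDyer.Rank1Residual.Additive.QuadraticBaseChangeTamagawaCanonicalModelOddPrime
import HarnessLib

/-!
# The LOWER twin of line V17 (ranks `(0,1)`, `p = 3`, `K = ℚ(ζ₃)`) with NO local-population
# hypothesis — Milne's A73 AND A233 PROVED AWAY (cell `b2b-bsdres`, team n1011, seat p16 GEN 10;
# row T-MIL-CAN FILE 6 = FILE 5 `_of_sumFibre` ∘ FILE 4 `sumFibre_of_natAbs_discr_eq`)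

HONEST FRAMING (cell `b2b-bsdres`, run/shared/lean/b2b/bsd-rank1-residual/, verbatim in every
file): the goal of the cell is to DELETE the COMBINATION-SHAPED residual classes of the
Birch–Swinnerton-Dyer formula for ALL analytic-rank `≤ 1` elliptic curves over `ℚ` — "full BSD
formula for every rank `≤ 1` curve in class `C`" assembled STRICTLY from published theorems — so
that the rank-`≤ 1` remainder becomes exactly the CONSTRUCTION-SHAPED classes, which are TYPED
(missing-input `Prop`s), NOT attempted. This is not "finishing BSD". Team n1011 (N10 / N11), seat p16:
research route; X3 / X4 / N10 / N11 labels and marks UNCHANGED; nothing booked. Theorems only.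

`…exists_padicVal_shaAn_add_le_noLocal`: the (0,1) ℚ(ζ₃) LOWER line for EVERY X4♯(G-ord)@3 pair
(`V` good ordinary at `3`, `W = C • V^{(−3)}` additive at `3`) with NO hypothesis on the reduction of
`V` at the other places: the per-place fibre identities (T) hold at every place by FILE 4's
`sumFibre_of_natAbs_discr_eq` (`|d_K| = 3`, `V` good at `3`: n1011-p01's T-MIL-3/H-5a per-place
theorem — row T-MIL-B2 inside at an inert `2` of type IV/IV* — with A233 fed by row T-A233's
`…UnramifiedBaseChange.kodairaSymbolAt_baseChange_of_ramificationIdx_eq_one_holds`).  Binder diff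
against p306279 `…_of_semistable`: `hS` DELETED, nothing added.  A73 (`hMilne`) is not used; THE
RESIDUAL INPUT `hLowK` is untouched. Nothing booked; no mark moves.
-/

noncomputable section

open scoped Classical MatrixGroups ModularForm

open CongruenceSubgroup WeierstrassCurve NumberField IsDedekindDomain Rat.HeightOneSpectrum
  Literature.NumberTheory.EllipticCurves Literature.NumberTheory.EllipticCurves.ModularForms
  Literature.NumberTheory.EllipticCurves.Rank1Residual
  Literature.NumberTheory.EllipticCurves.Rank1Residual.Typed
  Literature.NumberTheory.GaloisRepresentations

namespace Summit.BirchSwinnertonDyer.Rank1Residual.Additive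

section Addv

variable (K : Type) [Field K] [NumberField K] [IsCyclotomicExtension {3} ℚ K]
  (V : WeierstrassCurve ℚ) [V.IsElliptic] [V.IsGloballyMinimal]
  (W : WeierstrassCurve ℚ) [W.IsElliptic] [W.IsGloballyMinimal]

/-- **LOWER twin of line V17, ranks `(0,1)`, `p = 3`, `K = ℚ(ζ₃)` — NO local-population hypothesis,
NO `hMilne`, NO `hA`**: `…_of_sumFibre` (FILE 5) with the fibre identities (T) supplied at EVERY place
by `sumFibre_of_natAbs_discr_eq` (FILE 4: n1011-p01's T-MIL-3 H-5a + rows T-MIL-B2 and T-A233).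
[cite: GreenbergLNM1716, §4 p. 110] [cite: PerrinRiou1987, §1.4 Cor. 1.8]
[cite: Kato2004Asterisque, Thm. 17.4 (p. 273) (torsion clause)]
[cite: Milne1972ArithmeticAV, §1 Thm. 1 and §2 (through DokchitserDokchitserAnnals2010, §2.1, proof of Thm. 8)]
[cite: SilvermanAEC2009, Prop. VII.5.4 (a)] -/
theorem XGordRankZeroOneCyclotomicThreeLower.exists_padicVal_shaAn_add_le_noLocal
    (hPR : perrinRiou_rankOne_leadingTerms_odd)
    (hGZK : rank_eq_analyticRank_of_analyticRank_le_one) (hmod : hasEntireLFunction_rat)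
    (C : VariableChange ℚ) (hC : C • V.quadraticTwist (-(3 : ℚ)) = W)
    (hord : IsOrdinaryAt V 3) (hadd : Addv W 3)
    (hrV : V.analyticRank = 1) (hrW : W.analyticRank = 0)
    {N : ℕ} [NeZero N] {f : CuspForm (Gamma0 N) 2} (hf : IsNewformOf V f)
    (ϖ ϖ' : ℚ) (hϖ : (ϖ : ℝ) * V.realPeriodRat = plusPeriod f)
    (hϖ' : (ϖ' : ℝ) * V.imaginaryPeriodRat = minusPeriod f)
    (Dh : PAdicHeightData V 3) (hDh : Dh.IsCanonical)
    (hcert : PowerSeries.coeff 1 (padicLFunction f ((unitRoot V 3 : ℤ_[3]) : ℚ_[3])) ≠ 0)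
    (hTorK : ∀ (κ : ZpExtension K 3) (γ : Field.absoluteGaloisGroup K),
      κ.IsCyclotomic → κ.IsTopGenerator γ →
      (∃ ζ : ℤ_[3]ˣ, IsOfFinOrder ζ ∧
        ((GaloisRep.cyclotomicCharacter K 3 γ * ζ : ℤ_[3]ˣ) : ℤ_[3]) = (cyclotomicGenerator 3 : ℤ_[3])) →
      ∀ D : (V.baseChange K).SelmerDualData κ γ, D.IsTorsion)
    (hLowK : ∀ (κ : ZpExtension K 3) (γ : Field.absoluteGaloisGroup K),
      κ.IsCyclotomic → κ.IsTopGenerator γ →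
      (∃ ζ : ℤ_[3]ˣ, IsOfFinOrder ζ ∧
        ((GaloisRep.cyclotomicCharacter K 3 γ * ζ : ℤ_[3]ˣ) : ℤ_[3]) = (cyclotomicGenerator 3 : ℤ_[3])) →
      ∀ D : (V.baseChange K).SelmerDualData κ γ, ∀ g ∈ D.charIdeal, ∃ h : IwasawaAlgebra 3,
        iwasawaToPowerSeries 3 g =
          iwasawaToPowerSeries 3 h *
            (PowerSeries.C ((ϖ : ℚ_[3]) * (ϖ' : ℚ_[3])) *
              (padicLFunction f ((unitRoot V 3 : ℤ_[3]) : ℚ_[3]) *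
                padicLFunctionMinusBranch f ((unitRoot V 3 : ℤ_[3]) : ℚ_[3]) 1)))
    (hS1K : ∀ (κ : ZpExtension K 3) (γ : Field.absoluteGaloisGroup K),
      κ.IsCyclotomic → κ.IsTopGenerator γ →
      (∃ ζ : ℤ_[3]ˣ, IsOfFinOrder ζ ∧
        ((GaloisRep.cyclotomicCharacter K 3 γ * ζ : ℤ_[3]ˣ) : ℤ_[3]) = (cyclotomicGenerator 3 : ℤ_[3])) →
      ∀ (D : (V.baseChange K).SelmerDualData κ γ) [Module.Finite (IwasawaAlgebra 3) D.X], D.IsTorsion →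
      ∀ (fE : IwasawaAlgebra 3), D.charIdeal = Ideal.span {fE} →
        (V.baseChange K).mordellWeilRank = 1 →
        Finite (AddCommGroup.primaryComponent (V.baseChange K).sha 3) →
      ∀ (Q : (V.baseChange K).toAffine.Point), IsMordellWeilBasis (fun _ : Fin 1 => Q) →
      ∀ (Dh : PAdicHeightData V 3), Dh.IsCanonical →
        PowerSeries.X ∣ fE ∧
        ∃ DK : PAdicHeightDataK V 3 K, DK.RestrictsTo Dh ∧
          ∃ u : ℤ_[3]ˣ,
            ((PowerSeries.coeff 1 fE : ℤ_[3]) : ℚ_[3]) * padicLog 3 (cyclotomicGenerator 3) *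
                (Nat.card (AddCommGroup.primaryComponent (V.baseChange K).toAffine.Point 3) : ℚ_[3]) ^ 2 =
              ((u : ℤ_[3]) : ℚ_[3]) * DK.pairing Q Q *
                (3 : ℚ_[3]) ^ (padicValNat 3 (V.baseChange K).tamagawaProduct) *
                (Nat.card (AddCommGroup.primaryComponent
                  ((integralModelInt V).map (Int.castRingHom (ZMod 3))).toAffine.Point 3) : ℚ_[3]) ^ 2 *
                (Nat.card (AddCommGroup.primaryComponent (V.baseChange K).sha 3) : ℚ_[3])) :
    ∃ qV qW : ℚ, shaAn V = (qV : ℂ) ∧ shaAn W = (qW : ℂ) ∧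
      padicValRat 3 qV + padicValRat 3 qW ≤ (padicValNat 3 V.shaOrder : ℤ) + padicValNat 3 W.shaOrder  := by
  have h2 : Module.finrank ℚ K = 2 := finrank_eq_two_of_isCyclotomicExtension_three (K := K)
  have hdK : (NumberField.discr K : ℚ) = -(3 : ℚ) := by
    rw [discr_cyclotomicThree K]; norm_num
  have hC' : C • V.quadraticTwist (NumberField.discr K : ℚ) = W := by rw [hdK]; exact hC
  have hdKabs : (NumberField.discr K).natAbs = 3 := by rw [discr_cyclotomicThree K]; rfl
  exact XGordRankZeroOneCyclotomicThreeLower.exists_padicVal_shaAn_add_le_of_sumFibre K V W hPR hGZK hmod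
    (sumFibre_of_natAbs_discr_eq K V W 3 h2 hC' (by norm_num) hdKabs (Or.inl hord.1))
    C hC hord hadd hrV hrW hf ϖ ϖ' hϖ hϖ' Dh hDh hcert hTorK hLowK hS1K

end Addv

end Summit.BirchSwinnertonDyer.Rank1Residual.Additive

end
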